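import Summits.QuantumFields.BalabanUV.Beta.GAN24.ResolventLegCharges
import Summits.QuantumFields.BalabanUV.Beta.BorderedHessianSymmetry
import Summits.QuantumFields.BalabanUV.Beta.TameKernelCalculus

/-!
# `BalabanUV.Beta.GAN24.LegWeightedDressedRow` — binder row G-an2-4 ∕ (CONV-C), W-slot CT-W, conservation law (C)∕(C)sym AT LEVELS `j ≥ 1`, T2b-(i) of this lineage's note
# `HOME/b2b-balaban-gan24-formalise-leaf-04/g68/EXIT-FACE-CURRENT-TOWER.md`: **THE LEG-WEIGHTED MULTIPLIER ROW OF A `sgnK`-SYMMETRIC KERNEL COMPOSED WITH A LOCAL VERTEX IS MINUS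
# THE FIELD RESPONSE TO THE LEG DATUM (PLUS THE MULTIPLIER RESPONSE) READ ON THE VERTEX's FIRST LEG** —
# `Σ'_w ρ(w)·(K ∘ V)(N•w, inr β; v, f) = −Σ_κ″ Σ'_q (Σ'_w ρ(w)·colH K N β w κ″ q)·V q v (inl κ″) f + Σ_m Σ'_q (Σ'_w ρ(w)·K q (N•w) (inr m) (inr β))·V q v (inr m) f`

NOT IN PRINT; OUR BOOKKEEPING ([folklore] `tsum` bookkeeping BY NAME over an2's `OneStepKernelFamily.colH`, an2∕leaf-02's `BorderedHessianSymmetry` (`sgnK`, `sgnF`), an5's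
`TameKernelCalculus` (`trK`), `ExpKernelCalculus`, `ResolventLegCharges.summable_exp_coarse′`; G-an2-4 formalisation swarm, leaf prover `b2b-balaban-gan24-formalise-leaf-04`, gen 68).
HONEST FRAMING (cell contract, verbatim): «discharging `BetaPertH` makes Bałaban's UV stability UNCONDITIONAL — a real constructive-QFT result; it is NOT the continuum limit and NOT the
Clay problem.»  HONEST DEPENDENCY (verbatim): «continuum YM on T⁴ ⇐ BetaPertH ∧ nine spine estimates (0/9 proved); BetaPertH ⇐ (D1) ∧ (D4) ∧ CAP+tail; G-an2-4 gates asym, D1 and NE2/3/4.»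

WHY.  In `ExitFaceCurrentDivStep.div_faceSlot_current_eq` the leg weight `ρ` of the level-`(j+1)` current multiplies the multiplier row `(Lc•w, inr β)` of `G_j ∘ vertexOfK G_j Lc S ν t`;
for the dressed step kernel (`trK G_j = sgnK G_j`, leaf-02's `trK_coDressKBmAt_KInvStep`) that row is minus the COLUMN `(·; Lc•w, inr β)`, i.e. the response to the datum `ρ ê_β`: its field
part `H_j(ρ ê_β)` is the level-`j` LEG datum of the tower, its multiplier part `C_j(ρ ê_β)` vanishes for the face weight ((S2c) + p2's `CoarseGaugeSourceResponse.sum_tsum_coarseGrad_colM`;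
not in this file).

WHAT ([folklore]; generic `d`, blocking `1 ≤ N`, ANY decaying `sgnK`-symmetric `K`, ANY kernel `V` bi-localised at one point, bounded `ρ`; 0 `def`, 0 cited facts, 0 `def … : Prop`, 0 sorry):
`summable_legRow_pair` (the `(w, q)` family is absolutely summable), `mulRow_eq_neg_col` (`K (N•w) q (inr β) g = −sgnF g·K q (N•w) g (inr β)`), **`tsum_legWeight_mulRow_comp`** (the headline).
Asserts NO value of Bałaban's tables; discharges NOTHING of (C)sym ∕ (Q-D) ∕ (Q-D-rate) ∕ «T2Shape» ∕ «T2Drift» ∕ (hW, hWall); NEVER «G-an2-4 closed» as (CONV-C); NOT D1, NOT `BetaPertH`, NOT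
continuum, NOT Clay.  2026-08-23; no existing file touched.
-/

noncomputable section

open Finset
open scoped BigOperators
open Literature.MathematicalPhysics.QuantumFieldTheory
open Literature.MathematicalPhysics.QuantumFieldTheory.Balaban1983to89
open Literature.MathematicalPhysics.QuantumFieldTheory.Balaban1983to89.Beta
open B12Sec2to5 (l1 l1_nonneg)
open ExpKernelCalculus (Site MKer comp Decays BiLoc Zl Zl_nonneg exp_split summable_exp_shift summable_exp_shift' tsum_exp_shift tsum_exp_shift' l1_sub_symm)
open OneStepResolventKernel (Fib)
open OneStepKernelFamily (colH abs_colH_le)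
open Summit.QuantumFields.BalabanUV.Beta.TameKernelCalculus (trK trK_apply)
open Summit.QuantumFields.BalabanUV.Beta.BorderedHessian (sgnK sgnK_apply sgnF sgnF_inl sgnF_inr)
open Summit.QuantumFields.BalabanUV.Beta.GAN24.ResolventLegCharges (summable_exp_coarse')

namespace Summit.QuantumFields.BalabanUV.Beta.GAN24.LegWeightedDressedRow

variable {d : ℕ} {N : ℕ}

/-- [folklore] **A MULTIPLIER ROW OF A `sgnK`-SYMMETRIC KERNEL IS MINUS (THE SIGN OF THE OTHER LEG TIMES) THE CORRESPONDING COLUMN**: `K (N•w) q (inr β) g = −sgnF g·K q (N•w) g (inr β)`. -/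
theorem mulRow_eq_neg_col {K : MKer (d + 1) (Fib d)} (hKt : trK K = sgnK K) (w q : Site (d + 1)) (β : Fin (d + 1)) (g : Fib d) :
    K ((N : ℤ) • w) q (Sum.inr β) g = -(sgnF g * K q ((N : ℤ) • w) g (Sum.inr β)) := by
  have h := congrFun (congrFun (congrFun (congrFun hKt q) ((N : ℤ) • w)) g) (Sum.inr β)
  rw [trK_apply, sgnK_apply, sgnF_inr] at h
  rw [h]; ring

/-- [folklore] **THE `(leg site, middle site)` FAMILY `ρ(w)·K (N•w) q (inr β) g·V q v g f` IS ABSOLUTELY SUMMABLE** (decaying `K`, `V` bi-localised at `(p, p)`, bounded `ρ`, `1 ≤ N`). -/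
theorem summable_legRow_pair (hN : 1 ≤ N) {K : MKer (d + 1) (Fib d)} {C δ : ℝ} (hK : Decays K C δ) (hδ : 0 < δ)
    {V : MKer (d + 1) (Fib d)} {p : Site (d + 1)} {Cv δv : ℝ} (hV : BiLoc V p p Cv δv) (hδv : 0 < δv)
    {ρ : Site (d + 1) → ℝ} {B : ℝ} (hρ : ∀ w, |ρ w| ≤ B) (β : Fin (d + 1)) (v : Site (d + 1)) (g f : Fib d) :
    Summable fun wq : Site (d + 1) × Site (d + 1) => |ρ wq.1 * K ((N : ℤ) • wq.1) wq.2 (Sum.inr β) g * V wq.2 v g f| := by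
  have hC : 0 ≤ C := hK.nonneg (Sum.inl 0)
  have hCv : 0 ≤ Cv := hV.nonneg (Sum.inl 0)
  have hB : 0 ≤ B := (abs_nonneg _).trans (hρ 0)
  obtain ⟨m, hm0, hmδ, hmδv⟩ : ∃ m : ℝ, 0 < m ∧ m ≤ δ ∧ m ≤ δv := ⟨min δ δv, lt_min hδ hδv, min_le_left _ _, min_le_right _ _⟩
  have hm2 : 0 < m / 2 := half_pos hm0
  have hm4 : 0 < m - m / 2 := by linarith
  -- majorant `(B·C·Cv)·e^{−(m−m/2)|p − q|}·e^{−(m/2)|p − N w|}`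
  have hMs : Summable fun wq : Site (d + 1) × Site (d + 1) =>
      (B * C * Cv) * (Real.exp (-(m - m / 2) * l1 (p - wq.2)) * Real.exp (-(m / 2) * l1 (p - (N : ℤ) • wq.1))) := by
    refine Summable.mul_left (B * C * Cv) ?_
    refine (summable_prod_of_nonneg (fun wq => mul_nonneg (Real.exp_pos _).le (Real.exp_pos _).le)).2 ⟨fun w => ?_, ?_⟩
    · show Summable fun q : Site (d + 1) => Real.exp (-(m - m / 2) * l1 (p - q)) * Real.exp (-(m / 2) * l1 (p - (N : ℤ) • w))
      exact (summable_exp_shift hm4 p).mul_right (Real.exp (-(m / 2) * l1 (p - (N : ℤ) • w)))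
    · have e : ∀ w : Site (d + 1), ∑' q : Site (d + 1), Real.exp (-(m - m / 2) * l1 (p - q)) * Real.exp (-(m / 2) * l1 (p - (N : ℤ) • w)) =
          Zl (d + 1) (m - m / 2) * Real.exp (-(m / 2) * l1 (p - (N : ℤ) • w)) := fun w => by rw [tsum_mul_right, tsum_exp_shift]
      show Summable fun w : Site (d + 1) => ∑' q : Site (d + 1), Real.exp (-(m - m / 2) * l1 (p - q)) * Real.exp (-(m / 2) * l1 (p - (N : ℤ) • w))
      simp only [e]
      exact (summable_exp_coarse' (d := d) hN hm2 p).mul_left (Zl (d + 1) (m - m / 2))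
  refine Summable.of_nonneg_of_le (fun _ => abs_nonneg _) (fun wq => ?_) hMs
  rw [abs_mul, abs_mul]
  have h1 := hρ wq.1
  have h2 : |K ((N : ℤ) • wq.1) wq.2 (Sum.inr β) g| ≤ C * Real.exp (-m * l1 (wq.2 - (N : ℤ) • wq.1)) := by
    refine (hK _ _ _ _).trans (mul_le_mul_of_nonneg_left (Real.exp_le_exp.2 ?_) hC)
    rw [l1_sub_symm]
    nlinarith [l1_nonneg (wq.2 - (N : ℤ) • wq.1)]
  have h3 : |V wq.2 v g f| ≤ Cv * Real.exp (-m * l1 (p - wq.2)) := by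
    refine (hV wq.2 v g f).trans (mul_le_mul_of_nonneg_left (Real.exp_le_exp.2 ?_) hCv)
    rw [l1_sub_symm p wq.2]
    nlinarith [l1_nonneg (wq.2 - p), l1_nonneg (v - p)]
  have h4 : Real.exp (-m * l1 (p - wq.2)) * Real.exp (-m * l1 (wq.2 - (N : ℤ) • wq.1)) ≤
      Real.exp (-(m - m / 2) * l1 (p - wq.2)) * Real.exp (-(m / 2) * l1 (p - (N : ℤ) • wq.1)) :=
    exp_split hm2.le (by linarith) p wq.2 ((N : ℤ) • wq.1)
  calc |ρ wq.1| * |K ((N : ℤ) • wq.1) wq.2 (Sum.inr β) g| * |V wq.2 v g f|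
      ≤ B * (C * Real.exp (-m * l1 (wq.2 - (N : ℤ) • wq.1))) * (Cv * Real.exp (-m * l1 (p - wq.2))) :=
        mul_le_mul (mul_le_mul h1 h2 (abs_nonneg _) hB) h3 (abs_nonneg _) (by positivity)
    _ = (B * C * Cv) * (Real.exp (-m * l1 (p - wq.2)) * Real.exp (-m * l1 (wq.2 - (N : ℤ) • wq.1))) := by ring
    _ ≤ (B * C * Cv) * (Real.exp (-(m - m / 2) * l1 (p - wq.2)) * Real.exp (-(m / 2) * l1 (p - (N : ℤ) • wq.1))) :=
        mul_le_mul_of_nonneg_left h4 (by positivity)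

/-- [folklore] **THE LEG-WEIGHTED MULTIPLIER ROW OF `K ∘ V`** (decaying `sgnK`-symmetric `K`, `V` bi-localised at one point, bounded `ρ`, `1 ≤ N`):
`Σ'_w ρ(w)·(K ∘ V)(N•w, v)(inr β, f) = −Σ_κ″ Σ'_q (Σ'_w ρ(w)·colH K N β w κ″ q)·V q v (inl κ″) f + Σ_m Σ'_q (Σ'_w ρ(w)·K q (N•w) (inr m) (inr β))·V q v (inr m) f` —
the field part is MINUS the field response `H(ρ ê_β)` to the leg datum, read on the first leg of `V`; the multiplier part is the multiplier response `C(ρ ê_β)`. -/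
theorem tsum_legWeight_mulRow_comp (hN : 1 ≤ N) {K : MKer (d + 1) (Fib d)} {C δ : ℝ} (hK : Decays K C δ) (hδ : 0 < δ) (hKt : trK K = sgnK K)
    {V : MKer (d + 1) (Fib d)} {p : Site (d + 1)} {Cv δv : ℝ} (hV : BiLoc V p p Cv δv) (hδv : 0 < δv)
    {ρ : Site (d + 1) → ℝ} {B : ℝ} (hρ : ∀ w, |ρ w| ≤ B) (β : Fin (d + 1)) (v : Site (d + 1)) (f : Fib d) :
    ∑' w : Site (d + 1), ρ w * comp K V ((N : ℤ) • w) v (Sum.inr β) f =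
      -(∑ κ'' : Fin (d + 1), ∑' q : Site (d + 1), (∑' w : Site (d + 1), ρ w * colH K N β w κ'' q) * V q v (Sum.inl κ'') f) +
        ∑ m : Fin (d + 1), ∑' q : Site (d + 1), (∑' w : Site (d + 1), ρ w * K q ((N : ℤ) • w) (Sum.inr m) (Sum.inr β)) * V q v (Sum.inr m) f := by
  classical
  -- the pair families, one per middle leg `g`
  have hF : ∀ g : Fib d, Summable fun wq : Site (d + 1) × Site (d + 1) => ρ wq.1 * K ((N : ℤ) • wq.1) wq.2 (Sum.inr β) g * V wq.2 v g f :=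
    fun g => Summable.of_norm_bounded (summable_legRow_pair hN hK hδ hV hδv hρ β v g f) (fun wq => by rw [Real.norm_eq_abs])
  -- unfold the composition and split the middle leg into its finite sum
  have hpt : ∀ w : Site (d + 1), ρ w * comp K V ((N : ℤ) • w) v (Sum.inr β) f =
      ∑ g : Fib d, ∑' q : Site (d + 1), ρ w * K ((N : ℤ) • w) q (Sum.inr β) g * V q v g f := by
    intro w
    simp only [comp]
    rw [← tsum_mul_left]
    have e : ∀ q : Site (d + 1), ρ w * ∑ g : Fib d, K ((N : ℤ) • w) q (Sum.inr β) g * V q v g f =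
        ∑ g : Fib d, ρ w * K ((N : ℤ) • w) q (Sum.inr β) g * V q v g f := fun q => by
      rw [Finset.mul_sum]; exact Finset.sum_congr rfl fun g _ => by ring
    rw [tsum_congr e, Summable.tsum_finsetSum (fun g _ => ?_)]
    exact (hF g).prod_factor w
  rw [tsum_congr hpt, Summable.tsum_finsetSum (fun g _ => (hF g).prod), Fintype.sum_sum_type]
  -- swap `w` and `q` in each `g`-term
  have hsw : ∀ g : Fib d, ∑' w : Site (d + 1), ∑' q : Site (d + 1), ρ w * K ((N : ℤ) • w) q (Sum.inr β) g * V q v g f =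
      ∑' q : Site (d + 1), (∑' w : Site (d + 1), ρ w * K ((N : ℤ) • w) q (Sum.inr β) g) * V q v g f := by
    intro g
    rw [← (hF g).tsum_prod, ← (Equiv.prodComm (Site (d + 1)) (Site (d + 1))).tsum_eq (fun wq : Site (d + 1) × Site (d + 1) => ρ wq.1 * K ((N : ℤ) • wq.1) wq.2 (Sum.inr β) g * V wq.2 v g f)]
    have hF' : Summable fun qw : Site (d + 1) × Site (d + 1) => ρ qw.2 * K ((N : ℤ) • qw.2) qw.1 (Sum.inr β) g * V qw.1 v g f :=
      ((Equiv.prodComm (Site (d + 1)) (Site (d + 1))).summable_iff.2 (hF g)).congr fun qw => by simp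
    simp only [Equiv.prodComm_apply, Prod.fst_swap, Prod.snd_swap]
    rw [hF'.tsum_prod]
    exact tsum_congr fun q => by rw [← tsum_mul_right]
  simp only [hsw]
  -- the sign flip on field middle legs, none on multiplier middle legs
  have e_inl : ∀ (κ'' : Fin (d + 1)) (q : Site (d + 1)), (∑' w : Site (d + 1), ρ w * K ((N : ℤ) • w) q (Sum.inr β) (Sum.inl κ'')) =
      -∑' w : Site (d + 1), ρ w * colH K N β w κ'' q := by
    intro κ'' q
    rw [← tsum_neg]
    refine tsum_congr fun w => ?_
    rw [mulRow_eq_neg_col hKt w q β (Sum.inl κ''), sgnF_inl, one_mul, colH]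
    ring
  have e_inr : ∀ (m : Fin (d + 1)) (q : Site (d + 1)), (∑' w : Site (d + 1), ρ w * K ((N : ℤ) • w) q (Sum.inr β) (Sum.inr m)) =
      ∑' w : Site (d + 1), ρ w * K q ((N : ℤ) • w) (Sum.inr m) (Sum.inr β) := by
    intro m q
    refine tsum_congr fun w => ?_
    rw [mulRow_eq_neg_col hKt w q β (Sum.inr m), sgnF_inr]
    ring
  simp only [e_inl, e_inr, neg_mul, tsum_neg, Finset.sum_neg_distrib]

end Summit.QuantumFields.BalabanUV.Beta.GAN24.LegWeightedDressedRow

end
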